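import Mathlib
import Literature.MathematicalPhysics.QuantumFieldTheory.LatticeMirrorNormals
import Literature.MathematicalPhysics.QuantumFieldTheory.MirrorRPKernel

/-!
# Crux `HyperoctahedralRP.HRP2Rigidity` (stmt-CriticalPhenomena-1979) — negative-side support: WHERE the quartic witness fails

`Negative/LoadBearing.lean` shows that reflection positivity is load-bearing in the nine-mirror rigidity theorem:
the `O_h`-invariant quartic kernel `K x = (Σ xᵢ⁴)/(Σ xᵢ²)³` (degree `-2`) satisfies every other hypothesis and is
anisotropic.  By the (proved) theorem `nineMirrorRigidityBelowFour` this kernel must therefore VIOLATE reflection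
positivity for at least one of the nine mirrors.  This THEOREM-ONLY file records the explicit violation used in the
paper draft of the result (Remark "Where the quartic kernel fails"): for the DIAGONAL mirror `n = e₀ + e₁` and the
two-point configuration `p = (-1, 2, -2)`, `q = (-1/2, 3/2, -2)` (both with `⟪·, n⟫ = 1 > 0`) with coefficients
`(1, -1)`, the Gram form is

  `K(p - θp) + K(q - θq) - K(p - θq) - K(q - θp) = 1/4 + 1/4 - 41/125 - 41/125 = -39/250 < 0`,

since `p - θ_n p = q - θ_n q = (1,1,0)`, `p - θ_n q = (1/2, 3/2, 0)`, `q - θ_n p = (3/2, 1/2, 0)`.  Hence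
`¬ IsMirrorRPKernel (e₀ + e₁) K` (`quartic_not_isMirrorRPKernel_diag`).  Exact rational arithmetic only; no
definitions.  (O(3) writer seat, cell pub-ising3x, 2026-08-25; supports item stmt-CriticalPhenomena-1979.)
-/

noncomputable section

open scoped BigOperators InnerProductSpace

namespace Summit.CriticalPhenomena.Ising3DConformalLimit.Theorems.HRP2Rigidity.Negative

open Literature.MathematicalPhysics.QuantumFieldTheory

/-- Coordinates of a combination `a e₀ + b e₁ + c e₂` of the standard basis vectors of `ℝ³`. [folklore] -/
theorem quarticWitness_coords (a b c : ℝ) :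
    ((a • EuclideanSpace.single (0 : Fin 3) (1 : ℝ) + b • EuclideanSpace.single 1 1 +
        c • EuclideanSpace.single 2 1 : EuclideanSpace ℝ (Fin 3)) 0 = a) ∧
    ((a • EuclideanSpace.single (0 : Fin 3) (1 : ℝ) + b • EuclideanSpace.single 1 1 +
        c • EuclideanSpace.single 2 1 : EuclideanSpace ℝ (Fin 3)) 1 = b) ∧
    ((a • EuclideanSpace.single (0 : Fin 3) (1 : ℝ) + b • EuclideanSpace.single 1 1 +
        c • EuclideanSpace.single 2 1 : EuclideanSpace ℝ (Fin 3)) 2 = c) := by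
  refine ⟨?_, ?_, ?_⟩ <;> simp

/-- **Where the quartic witness fails (paper Remark "Where the quartic kernel fails").**  The `O_h`-invariant
quartic kernel `(Σ xᵢ⁴)/(Σ xᵢ²)³` is NOT reflection positive for the diagonal lattice mirror `n = e₀ + e₁`:
on the two points `p = (-1,2,-2)`, `q = (-1/2,3/2,-2)` of the open half-space `⟪·,n⟫ > 0` with coefficients
`(1,-1)` the Gram form equals `1/4 + 1/4 - 41/125 - 41/125 = -39/250 < 0`. -/
theorem quartic_not_isMirrorRPKernel_diag :
    ¬ IsMirrorRPKernel (EuclideanSpace.single (0 : Fin 3) (1 : ℝ) + EuclideanSpace.single 1 1)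
        (fun x : EuclideanSpace ℝ (Fin 3) => (∑ i, x i ^ 4) / (∑ i, x i ^ 2) ^ 3) := by
  intro h
  set P : EuclideanSpace ℝ (Fin 3) :=
    (-1 : ℝ) • EuclideanSpace.single (0 : Fin 3) (1 : ℝ) + (2 : ℝ) • EuclideanSpace.single 1 1 +
      (-2 : ℝ) • EuclideanSpace.single 2 1 with hPdef
  set Q : EuclideanSpace ℝ (Fin 3) :=
    (-1 / 2 : ℝ) • EuclideanSpace.single (0 : Fin 3) (1 : ℝ) + (3 / 2 : ℝ) • EuclideanSpace.single 1 1 +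
      (-2 : ℝ) • EuclideanSpace.single 2 1 with hQdef
  have hP0 : P 0 = -1 := by rw [hPdef]; exact (quarticWitness_coords (-1) 2 (-2)).1
  have hP1 : P 1 = 2 := by rw [hPdef]; exact (quarticWitness_coords (-1) 2 (-2)).2.1
  have hP2 : P 2 = -2 := by rw [hPdef]; exact (quarticWitness_coords (-1) 2 (-2)).2.2
  have hQ0 : Q 0 = -1 / 2 := by rw [hQdef]; exact (quarticWitness_coords (-1 / 2) (3 / 2) (-2)).1
  have hQ1 : Q 1 = 3 / 2 := by rw [hQdef]; exact (quarticWitness_coords (-1 / 2) (3 / 2) (-2)).2.1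
  have hQ2 : Q 2 = -2 := by rw [hQdef]; exact (quarticWitness_coords (-1 / 2) (3 / 2) (-2)).2.2
  have h01 : (0 : Fin 3) ≠ 1 := by decide
  -- the reflection in the plane `x₀ + x₁ = 0`: `(x₀, x₁, x₂) ↦ (-x₁, -x₀, x₂)`
  have hθ0 : ∀ x : EuclideanSpace ℝ (Fin 3),
      ((ℝ ∙ (EuclideanSpace.single (0 : Fin 3) (1 : ℝ) + EuclideanSpace.single 1 1))ᗮ.reflection x) 0 = -x 1 := by
    intro x; rw [reflection_single_add_single_apply h01 x 0, if_pos rfl]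
  have hθ1 : ∀ x : EuclideanSpace ℝ (Fin 3),
      ((ℝ ∙ (EuclideanSpace.single (0 : Fin 3) (1 : ℝ) + EuclideanSpace.single 1 1))ᗮ.reflection x) 1 = -x 0 := by
    intro x; rw [reflection_single_add_single_apply h01 x 1, if_neg (by decide), if_pos rfl]
  have hθ2 : ∀ x : EuclideanSpace ℝ (Fin 3),
      ((ℝ ∙ (EuclideanSpace.single (0 : Fin 3) (1 : ℝ) + EuclideanSpace.single 1 1))ᗮ.reflection x) 2 = x 2 := by
    intro x; rw [reflection_single_add_single_apply h01 x 2, if_neg (by decide), if_neg (by decide)]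
  -- both points lie in the open half-space `⟪·, n⟫ > 0`
  have hpos : ∀ a : Fin 2, 0 < ⟪(![P, Q] : Fin 2 → EuclideanSpace ℝ (Fin 3)) a,
      (EuclideanSpace.single (0 : Fin 3) (1 : ℝ) + EuclideanSpace.single 1 1)⟫_ℝ := by
    intro a
    fin_cases a
    · simp only [Fin.zero_eta, Matrix.cons_val_zero]
      rw [real_inner_comm, inner_single_add_single_left, hP0, hP1]
      norm_num
    · simp only [Fin.mk_one, Matrix.cons_val_one, Matrix.cons_val_fin_one]
      rw [real_inner_comm, inner_single_add_single_left, hQ0, hQ1]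
      norm_num
  have key := h 2 ![P, Q] ![(1 : ℝ), -1] hpos
  -- evaluate the four kernel values: 1/4, 41/125, 41/125, 1/4
  simp only [Fin.sum_univ_two, Fin.sum_univ_three, Matrix.cons_val_zero, Matrix.cons_val_one,
    Matrix.cons_val_fin_one, PiLp.sub_apply, hθ0, hθ1, hθ2, hP0, hP1, hP2, hQ0, hQ1, hQ2] at key
  norm_num at key

end Summit.CriticalPhenomena.Ising3DConformalLimit.Theorems.HRP2Rigidity.Negative

end
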